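import Summits.QuantumFields.YangMills.Theorems.AlphaInputsT3ACv3AbelianCurl
import HarnessLib

/-!
# `AlphaInputsT3ACv3AbelianStokes` — STRATEGY B for 2′, toward (D6R-CHARGED): THE ABELIAN LATTICE STOKES FORMULA FOR A RECTANGLE — the flux of a one-form around an `m × n`
# rectangle is the sum of the curls of its `m·n` unit plaquettes; hence `|curl (linAvg04 a)| ≤ L²·(max |curl a|)` — lane `pub-balaban3d`, seat alpha-2 (g3)

WHAT (HOME `D6L-STATUS-alpha2-g3.md` §5 (b)–(c); over `…AbelianCurl`).  §1 run sums along straight lines (`runSum`, `wsum_replicate_true`, `wsum_replicate_false`); §2 the rectangle flux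
`rectSum a x μ ν m n` (the closed walk `m·e_μ, n·e_ν, −m·e_μ, −n·e_ν` from `x`) in terms of run sums, the strip and plaquette inductions, ★ `rectSum_eq_sum_curl`; §3 the square of
`…AbelianCurl` is the `L × L` rectangle, so ★★ `abs_curl_linAvg04_le`: `|curl (linAvg04 a)(y; μ, ν)| ≤ L²·B` whenever `|curl a| ≤ B` at every fine plaquette position
`offPt y n_r + s e_μ + t e_ν` (`s, t < L`) of every offset.
HONEST FRAMING.  Kernel algebra; nothing of [B10]∕[7]∕[4]'s estimates asserted; count-neutral helper toward R3 2′ (`stub_laneRecordsV3`, items 19935∕19936); nothing about d = 4, the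
continuum, or a mass gap.

References: T. Bałaban, Commun. Math. Phys. 98 (1985) 17–51 [Balaban1985Averaging] ((9) p.19, (14) p.19); CMP 109 (1987) 249–301 [Balaban1987RG1] ((0.4) p.253).
-/

set_option autoImplicit false

noncomputable section

namespace Summit.QuantumFields.YangMills.Theorems.AbelianEML

open scoped BigOperators
open Literature.MathematicalPhysics.QuantumFieldTheory.Balaban1983to89
open Literature.MathematicalPhysics.QuantumFieldTheory.Balaban1983to89.T4Continuum
open Literature.MathematicalPhysics.QuantumFieldTheory.Balaban1983to89.BlockAveraging (off Idx)
open Literature.MathematicalPhysics.QuantumFieldTheory.Balaban1983to89.BlockAveragingEMLProp2 (walkEnd_replicate_true shiftN_apply)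
open Literature.MathematicalPhysics.QuantumFieldTheory.Balaban1983to89.B10Eq47AxialChi (shiftN shiftN_zero shiftN_succ)

variable {P : Params} {j : ℕ}

/-! ## §1 Run sums along straight lines -/

/-- Iterated shifts in two directions commute. [folklore] -/
theorem shiftN_shiftN_comm (x : Site P j) (μ ν : Fin P.d) (m n : ℕ) : shiftN (shiftN x μ m) ν n = shiftN (shiftN x ν n) μ m := by
  funext κ
  simp only [shiftN_apply]
  split_ifs <;> ring

/-- A unit shift commutes with iterated shifts. [folklore] -/
theorem shift_shiftN_comm (x : Site P j) (μ ν : Fin P.d) (n : ℕ) : shiftN (x.shift μ) ν n = (shiftN x ν n).shift μ := by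
  have := shiftN_shiftN_comm x μ ν 1 n
  simpa [shiftN_succ] using this

/-- **THE RUN SUM**: `Σ_{s<m} a(x + s e_μ, μ)`. [cite: Balaban1984PropagatorsI, (1.7) p.18] -/
def runSum (a : PBond P j → ℝ) (x : Site P j) (μ : Fin P.d) (m : ℕ) : ℝ :=
  ∑ s ∈ Finset.range m, a ⟨shiftN x μ s, μ⟩

/-- `runSum` with one more step. [folklore] -/
theorem runSum_succ (a : PBond P j → ℝ) (x : Site P j) (μ : Fin P.d) (m : ℕ) :
    runSum a x μ (m + 1) = runSum a x μ m + a ⟨shiftN x μ m, μ⟩ := by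
  rw [runSum, Finset.sum_range_succ]; rfl

/-- `runSum` split at the first step. [folklore] -/
theorem runSum_succ' (a : PBond P j → ℝ) (x : Site P j) (μ : Fin P.d) (m : ℕ) :
    runSum a x μ (m + 1) = a ⟨x, μ⟩ + runSum a (x.shift μ) μ m := by
  induction m with
  | zero => simp [runSum]
  | succ m ih =>
    rw [runSum_succ, ih, runSum_succ, add_assoc, shiftN_succ, shift_shiftN_comm]

/-- The walk sum of a straight forward run is the run sum. [folklore] -/
theorem wsum_replicate_true (a : PBond P j → ℝ) (μ : Fin P.d) : ∀ (m : ℕ) (x : Site P j),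
    wsum a x (List.replicate m (μ, true)) = runSum a x μ m
  | 0, x => by simp [runSum]
  | m + 1, x => by rw [List.replicate_succ, wsum_cons_true, wsum_replicate_true a μ m, runSum_succ']

/-- The walk sum of a straight backward run from the far end is minus the run sum. [folklore] -/
theorem wsum_replicate_false (a : PBond P j → ℝ) (μ : Fin P.d) (m : ℕ) (x : Site P j) :
    wsum a (shiftN x μ m) (List.replicate m (μ, false)) = -runSum a x μ m := by
  rw [← wsum_replicate_true, ← walkEnd_replicate_true, ← wordRev_replicate_true, wsum_wordRev]

/-! ## §2 The rectangle flux and the abelian Stokes formula -/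

/-- **THE RECTANGLE FLUX** of `a` around the closed walk `m·e_μ, n·e_ν, −m·e_μ, −n·e_ν` from `x`. [cite: Balaban1985Averaging, (9) p.19] -/
def rectSum (a : PBond P j → ℝ) (x : Site P j) (μ ν : Fin P.d) (m n : ℕ) : ℝ :=
  wsum a x (List.replicate m (μ, true) ++ (List.replicate n (ν, true) ++ (List.replicate m (μ, false) ++ List.replicate n (ν, false))))

/-- The rectangle flux in terms of the four run sums. [folklore] -/
theorem rectSum_eq_runSum (a : PBond P j → ℝ) (x : Site P j) (μ ν : Fin P.d) (m n : ℕ) :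
    rectSum a x μ ν m n = runSum a x μ m + runSum a (shiftN x μ m) ν n - runSum a (shiftN x ν n) μ m - runSum a x ν n := by
  unfold rectSum
  rw [wsum_append, walkEnd_replicate_true, wsum_replicate_true, wsum_append, walkEnd_replicate_true, wsum_replicate_true, wsum_append,
    shiftN_shiftN_comm x μ ν m n, wsum_replicate_false]
  have hend : walkEnd (shiftN (shiftN x ν n) μ m) (List.replicate m (μ, false)) = shiftN x ν n := by
    have h1 : shiftN (shiftN x ν n) μ m = walkEnd (shiftN x ν n) (List.replicate m (μ, true)) := (walkEnd_replicate_true _ _ _).symm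
    rw [h1, ← wordRev_replicate_true, walkEnd_walkEnd_wordRev]
  rw [hend, wsum_replicate_false]
  ring

/-- **THE LATTICE CURL** of a one-form at `(x; μ, ν)`: `a(x,μ) + a(x+e_μ,ν) − a(x+e_ν,μ) − a(x,ν)`. [cite: Balaban1985Averaging, (9) p.19] -/
def curlAt (a : PBond P j → ℝ) (x : Site P j) (μ ν : Fin P.d) : ℝ :=
  a ⟨x, μ⟩ + a ⟨x.shift μ, ν⟩ - a ⟨x.shift ν, μ⟩ - a ⟨x, ν⟩

/-- The strip of height one: `Σ_{s<m}` unit curls. [folklore] -/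
theorem strip_eq_sum_curl (a : PBond P j → ℝ) (μ ν : Fin P.d) (z : Site P j) : ∀ m : ℕ,
    runSum a z μ m + a ⟨shiftN z μ m, ν⟩ - runSum a (z.shift ν) μ m - a ⟨z, ν⟩ = ∑ s ∈ Finset.range m, curlAt a (shiftN z μ s) μ ν
  | 0 => by simp [runSum]
  | m + 1 => by
    rw [Finset.sum_range_succ, ← strip_eq_sum_curl a μ ν z m, runSum_succ, runSum_succ, curlAt, shiftN_succ, shift_shiftN_comm]
    ring

/-- **★ THE ABELIAN STOKES FORMULA FOR A RECTANGLE**: the flux around the `m × n` rectangle is the sum of the curls of its unit plaquettes. [cite: Balaban1985Averaging, (9) p.19] -/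
theorem rectSum_eq_sum_curl (a : PBond P j → ℝ) (x : Site P j) (μ ν : Fin P.d) (m : ℕ) : ∀ n : ℕ,
    rectSum a x μ ν m n = ∑ t ∈ Finset.range n, ∑ s ∈ Finset.range m, curlAt a (shiftN (shiftN x ν t) μ s) μ ν
  | 0 => by rw [rectSum_eq_runSum]; simp [runSum]
  | n + 1 => by
    rw [Finset.sum_range_succ, ← rectSum_eq_sum_curl a x μ ν m n, rectSum_eq_runSum, rectSum_eq_runSum, ← strip_eq_sum_curl, runSum_succ, runSum_succ,
      shiftN_succ, shiftN_shiftN_comm x μ ν m n]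
    ring

/-- Hence `|rectSum| ≤ m·n·B` when every unit curl in the rectangle is bounded by `B`. [folklore] -/
theorem abs_rectSum_le (a : PBond P j → ℝ) (x : Site P j) (μ ν : Fin P.d) (m n : ℕ) {B : ℝ}
    (hB : ∀ s t : ℕ, s < m → t < n → |curlAt a (shiftN (shiftN x ν t) μ s) μ ν| ≤ B) :
    |rectSum a x μ ν m n| ≤ m * n * B := by
  rw [rectSum_eq_sum_curl]
  refine (Finset.abs_sum_le_sum_abs _ _).trans ?_
  calc ∑ t ∈ Finset.range n, |∑ s ∈ Finset.range m, curlAt a (shiftN (shiftN x ν t) μ s) μ ν|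
      ≤ ∑ t ∈ Finset.range n, ∑ s ∈ Finset.range m, B := by
        refine Finset.sum_le_sum fun t ht => (Finset.abs_sum_le_sum_abs _ _).trans (Finset.sum_le_sum fun s hs => ?_)
        exact hB s t (Finset.mem_range.mp hs) (Finset.mem_range.mp ht)
    _ = m * n * B := by simp [Finset.sum_const, Finset.card_range]; ring

/-! ## §3 The bound on the curl of the (0.4) linear average -/

/-- The square flux of `…AbelianCurl` is the `L × L` rectangle flux. [folklore] -/
theorem squareSum_eq_rectSum (a : PBond P j → ℝ) (y : Site P (j + 1)) (n : Fin P.d → ℤ) (μ ν : Fin P.d) :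
    squareSum a y n μ ν = rectSum a (offPt y n) μ ν P.L P.L := rfl

/-- **★★ THE CURL OF THE (0.4) LINEAR AVERAGE IS AT MOST `L²` TIMES THE LARGEST FINE CURL IN THE TRANSPORTED SQUARES**: if `|curl a| ≤ B` at every fine plaquette position
`offPt y n_r + t e_ν + s e_μ` (`s, t < L`) of every offset `r`, then `|curl (linAvg04 a)(y; μ, ν)| ≤ L²·B`. [cite: Balaban1987RG1, (0.4) p.253; Balaban1985Averaging, (14) p.19] -/
theorem abs_curl_linAvg04_le (a : PBond P j → ℝ) (y : Site P (j + 1)) (μ ν : Fin P.d) {B : ℝ}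
    (hB : ∀ (r : Fin P.d → Fin P.L) (s t : ℕ), s < P.L → t < P.L → |curlAt a (shiftN (shiftN (offPt y (off r)) ν t) μ s) μ ν| ≤ B) :
    |linAvg04 a ⟨y, μ⟩ + linAvg04 a ⟨y.shift μ, ν⟩ - linAvg04 a ⟨y.shift ν, μ⟩ - linAvg04 a ⟨y, ν⟩| ≤ (P.L : ℝ) ^ 2 * B := by
  rw [curl_linAvg04]
  have hI : (0 : ℝ) < Fintype.card (Idx P) := Nat.cast_pos.mpr Fintype.card_pos
  have hterm : ∀ i : Idx P, |squareSum a y (off i.1) μ ν| ≤ (P.L : ℝ) ^ 2 * B := by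
    intro i
    rw [squareSum_eq_rectSum]
    refine (abs_rectSum_le a _ μ ν P.L P.L fun s t hs ht => hB i.1 s t hs ht).trans ?_
    rw [sq]
  rw [abs_mul, abs_inv, abs_of_pos hI]
  calc (Fintype.card (Idx P) : ℝ)⁻¹ * |∑ i : Idx P, squareSum a y (off i.1) μ ν|
      ≤ (Fintype.card (Idx P) : ℝ)⁻¹ * ∑ i : Idx P, (P.L : ℝ) ^ 2 * B := by
        refine mul_le_mul_of_nonneg_left ((Finset.abs_sum_le_sum_abs _ _).trans (Finset.sum_le_sum fun i _ => hterm i)) (inv_nonneg.mpr hI.le)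
    _ = (P.L : ℝ) ^ 2 * B := by
        rw [Finset.sum_const, Finset.card_univ, nsmul_eq_mul]; field_simp

end Summit.QuantumFields.YangMills.Theorems.AbelianEML

end
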